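import Summits.BirchSwinnertonDyer.BirchSwinnertonDyer.Theorems.AlignedTransportAtTwoMainConjectureOfRankZeroBSDAtTwoSelmerLayerModel
import HarnessLib

/-!
# Route `AlignedTransportAtTwo`, crux C2 `MainConjectureOfRankZeroBSDAtTwo` (stmt-BirchSwinnertonDyer-22298):
# the layer Selmer model identification COMMUTES WITH RESTRICTION — `Φ ∘ res_{K → L} = res_{U ↪ Γ_K}`:
# the restriction `Sel_{p^∞}(E/K) → Sel_{p^∞}(E_L/L)` of file `SelmerPInftyRestriction` (Dokchitser–Dokchitser's map) is, under g39's
# `Φ : Sel_{p^∞}(E_L/L) ≃+ W.selmerGroupOver p U`, the plain restriction `H¹(Γ_K, E[p^∞]) → H¹(U, E[p^∞])` of the subgroup model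

HONEST FRAMING (cell `bsd-f1-sign2`, WIDTH-5 attached prover seat `bsd-line-att-p5` gen 39 on line `birth` of the lead `bsd-line-att-p2`;
`--supports` stmt-BirchSwinnertonDyer-22298, closes nothing; BSD is NOT proved by any of this; the crux C2, its verdict «blocked-on
`Rank1Residual.GreenbergMuConjectureIrreducible`» and every registered stub are untouched). THEOREMS ONLY — no `def`, no instance, no named fact,
no `sorry`. Sequel of `…SelmerLayerModel` (p787858): the compatibility that makes the identification composable with the tree's restriction
theorems (`resPrimary_mem_selmerGroupPInfty`, Dokchitser–Dokchitser 4.14 in the subgroup model `SelmerRestrictionCorank{,Relative}`,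
`resOfLe_mem_selmerGroupOver`).

* §1 (any `K ⊆ L` algebraic, `L` perfect, `U ≤ galRange L`) ★ `subgroupH1Iso_resH1Hom_subgroupIncl_resPrimary` —
  `subgroupH1Iso (res_{res⁻¹U} (res_{K→L} c)) = res_U c` on `H¹(Γ_K, E[p^∞])` (one compatible pair: `U → res⁻¹U → Γ_L → Γ_K` is the inclusion,
  `E[p^∞] → E_L[p^∞] → E[p^∞]` is the identity).
* §2 (number fields, `L/K` Galois, `U` normal with `res⁻¹U = Γ_L`) ★★ `coe_addEquiv_resPrimary_eq_resH1Hom_subgroupIncl` — for every `Φ` with g39's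
  formula and every `c ∈ Sel_{p^∞}(E/K)`: **`Φ (res_{K→L} c) = res_U c`**; `resH1Hom_subgroupIncl_mem_selmerGroupOver_of_mem`;
  layers (§3): ★★ `coe_addEquiv_resPrimary_layer_eq` (`U = κ⁻¹(pⁿℤ_p)`).

References: J.-P. Serre, *Galois Cohomology* (1997), I.§2.4 [SerreGaloisCohomology1997]; T. and V. Dokchitser, Ann. of Math. 172 (2010),
Lemma 4.14 (the restriction `Sel(E/K) → Sel(E/F)`) [DokchitserDokchitserAnnals2010]; R. Greenberg, LNM 1716 (1999), §3 [GreenbergLNM1716].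
-/

set_option linter.dupNamespace false
set_option autoImplicit false

noncomputable section

open scoped Classical

universe u

namespace Summit.BirchSwinnertonDyer.BirchSwinnertonDyer.Theorems.AlignedTransportAtTwoSelmerLayerModelRestriction

open WeierstrassCurve Literature.NumberTheory.EllipticCurves
  Summit.BirchSwinnertonDyer.Rank1Residual.Additive.BaseChange
  Summit.BirchSwinnertonDyer.BirchSwinnertonDyer.Theorems.AlignedTransportAtTwoSelmerLayerModel

/-! ## §1 One compatible pair: `subgroupH1Iso ∘ res_{res⁻¹U} ∘ res_{K→L} = res_U` -/

section Cohomology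

variable {K : Type u} [Field K] (L : Type u) [Field L] [Algebra K L] [Algebra.IsAlgebraic K L] [PerfectField L]
  (W : WeierstrassCurve K) (p : ℕ) {U : Subgroup (Field.absoluteGaloisGroup K)} (hU : U ≤ galRange (K := K) L)

/-- ★ **`subgroupH1Iso (res_{res⁻¹U} (res_{K→L} c)) = res_U c`** for every `c ∈ H¹(Γ_K, E[p^∞])`: the three maps are the maps of compatible pairs whose
composite is `(U ↪ Γ_K, id_{E[p^∞]})` — `resGal L (subgroupToComap τ) = τ` (`resGal_subgroupToComap`) and `e⁻¹ (e P) = P` for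
`e = primaryBaseChangeEquiv` (`= primaryBaseChangeMap`). [cite: SerreGaloisCohomology1997, I.§2.4] -/
theorem subgroupH1Iso_resH1Hom_subgroupIncl_resPrimary (c : W.galH1Primary p) :
    subgroupH1Iso L W p hU
        (resH1Hom (subgroupIncl (comapResGal L U)) (AddMonoidHom.id (geomPrimaryTorsion (W.baseChange L) p))
          (fun _ _ ↦ rfl) (resPrimary W L p c)) =
      resH1Hom (subgroupIncl U) (AddMonoidHom.id (geomPrimaryTorsion W p)) (fun _ _ ↦ rfl) c := by
  rw [subgroupH1Iso_apply, resPrimary, resH1Hom_resH1Hom, resH1Hom_resH1Hom]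
  refine DFunLike.congr_fun (resH1Hom_congr ?_ ?_ _ _) c
  · apply ContinuousMonoidHom.ext
    intro τ
    exact resGal_subgroupToComap L hU τ
  · apply AddMonoidHom.ext
    intro P
    change (primaryBaseChangeEquiv L W p).symm (primaryBaseChangeMap W L p P) = P
    rw [← primaryBaseChangeEquiv_apply, AddEquiv.symm_apply_apply]

end Cohomology

/-! ## §2 Selmer groups: `Φ (res_{K→L} c) = res_U c` -/

section Selmer

variable {K : Type u} [Field K] [NumberField K] (L : Type u) [Field L] [NumberField L] [Algebra K L]
  (W : WeierstrassCurve K) (p : ℕ) {U : Subgroup (Field.absoluteGaloisGroup K)} [U.Normal] (hU : U ≤ galRange (K := K) L)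

/-- ★★ **The model identification commutes with restriction.** For ANY additive isomorphism `Φ : Sel_{p^∞}(E_L/L) ≃+ W.selmerGroupOver p U` with g39's
formula (`…SelmerLayerModel.exists_addEquiv_selmerGroupPInfty_baseChange_selmerGroupOver`) and every `c ∈ Sel_{p^∞}(E/K)`: the image under `Φ` of the
restriction `res_{K→L} c ∈ Sel_{p^∞}(E_L/L)` (`resPrimary`, `resPrimary_mem_selmerGroupPInfty` — Dokchitser–Dokchitser's map) is the plain restriction
`res_U c ∈ H¹(U, E[p^∞])`. [cite: DokchitserDokchitserAnnals2010, Lemma 4.14 (proof)] [cite: SerreGaloisCohomology1997, I.§2.4] -/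
theorem coe_addEquiv_resPrimary_eq_resH1Hom_subgroupIncl
    (Φ : (W.baseChange L).selmerGroupPInfty p ≃+ W.selmerGroupOver p U)
    (hΦ : ∀ c : (W.baseChange L).selmerGroupPInfty p, ((Φ c : W.selmerGroupOver p U) : W.subgroupH1 p U) =
      subgroupH1Iso L W p hU
        (resH1Hom (subgroupIncl (comapResGal L U)) (AddMonoidHom.id (geomPrimaryTorsion (W.baseChange L) p))
          (fun _ _ ↦ rfl) (c : (W.baseChange L).galH1Primary p)))
    (c : W.selmerGroupPInfty p) :
    ((Φ ⟨resPrimary W L p (c : W.galH1Primary p), resPrimary_mem_selmerGroupPInfty W L p c.2⟩ : W.selmerGroupOver p U) :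
        W.subgroupH1 p U) =
      resH1Hom (subgroupIncl U) (AddMonoidHom.id (geomPrimaryTorsion W p)) (fun _ _ ↦ rfl) (c : W.galH1Primary p) := by
  rw [hΦ]
  exact subgroupH1Iso_resH1Hom_subgroupIncl_resPrimary L W p hU (c : W.galH1Primary p)

include hU in
/-- Hence the restriction `res_U c` of a Selmer class `c ∈ Sel_{p^∞}(E/K)` lies in `W.selmerGroupOver p U` (transport of
`resPrimary_mem_selmerGroupPInfty`; the tree's direct proof is `resOfLe_mem_selmerGroupOver`). [cite: GreenbergLNM1716, §3] -/
theorem resH1Hom_subgroupIncl_mem_selmerGroupOver_of_mem [IsGalois K L] (hS : ∀ σ : Field.absoluteGaloisGroup L, σ ∈ comapResGal L U)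
    (c : W.selmerGroupPInfty p) :
    resH1Hom (subgroupIncl U) (AddMonoidHom.id (geomPrimaryTorsion W p)) (fun _ _ ↦ rfl) (c : W.galH1Primary p) ∈
      W.selmerGroupOver p U := by
  obtain ⟨Φ, hΦ⟩ := exists_addEquiv_selmerGroupPInfty_baseChange_selmerGroupOver L W p hU hS
  rw [← coe_addEquiv_resPrimary_eq_resH1Hom_subgroupIncl L W p hU Φ hΦ c]
  exact (Φ _).2

end Selmer

/-! ## §3 The layers -/

section Layer

variable {K : Type u} [Field K] [NumberField K] (W : WeierstrassCurve K) {p : ℕ} [Fact p.Prime] (κ : ZpExtension K p) (n : ℕ)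

/-- ★★ **`Φ_n (res_{K → K_n} c) = res_{Γ_{K_n}} c`** for every `Φ_n : Sel_{p^∞}(E_{K_n}/K_n) ≃+ W.selmerLayer κ n` with g39's formula
(`exists_addEquiv_selmerGroupPInfty_layer_selmerLayer`) and every `c ∈ Sel_{p^∞}(E/K)`: restriction to the layer number field, read in the control
theorem's group, is restriction to `κ⁻¹(pⁿℤ_p)`. [cite: DokchitserDokchitserAnnals2010, Lemma 4.14 (proof)] [cite: GreenbergLNM1716, §3] -/
theorem coe_addEquiv_resPrimary_layer_eq
    (Φ : (W.baseChange (κ.layer n)).selmerGroupPInfty p ≃+ W.selmerLayer κ n)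
    (hΦ : ∀ c : (W.baseChange (κ.layer n)).selmerGroupPInfty p, ((Φ c : W.selmerLayer κ n) : W.subgroupH1 p (κ.layerSubgroup n)) =
      subgroupH1Iso (κ.layer n) W p (layerSubgroup_le_galRange_layer κ n)
        (resH1Hom (subgroupIncl (comapResGal (κ.layer n) (κ.layerSubgroup n)))
          (AddMonoidHom.id (geomPrimaryTorsion (W.baseChange (κ.layer n)) p))
          (fun _ _ ↦ rfl) (c : (W.baseChange (κ.layer n)).galH1Primary p)))
    (c : W.selmerGroupPInfty p) :
    ((Φ ⟨resPrimary W (κ.layer n) p (c : W.galH1Primary p), resPrimary_mem_selmerGroupPInfty W (κ.layer n) p c.2⟩ : W.selmerLayer κ n) :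
        W.subgroupH1 p (κ.layerSubgroup n)) =
      resH1Hom (subgroupIncl (κ.layerSubgroup n)) (AddMonoidHom.id (geomPrimaryTorsion W p)) (fun _ _ ↦ rfl) (c : W.galH1Primary p) :=
  coe_addEquiv_resPrimary_eq_resH1Hom_subgroupIncl (κ.layer n) W p (layerSubgroup_le_galRange_layer κ n) Φ hΦ c

end Layer

end Summit.BirchSwinnertonDyer.BirchSwinnertonDyer.Theorems.AlignedTransportAtTwoSelmerLayerModelRestriction

end
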